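import Literature.RingTheory.CentralSimple.ReducedDegreeCentralizerSimpleSubalgebra
import Literature.NumberTheory.ComplexMultiplication.CMAlgebraTorusMultiplicativeTypeCriterion
import HarnessLib

/-!
# Complex multiplication relative to a simple subalgebra `L ⊆ End_ℚ(X)`: the commutant of `L` in `End_ℚ(X)` has
# étale subalgebras of dimension at most `2 dim X / d`, with equality iff `X` has complex multiplication
# (Milne, *Complex Multiplication*, Ch. I §3 Exercise 3.10 (a)) — for EVERY complex torus

Family `hodge`, lane `lit-hodgefound` (Track 2 foundations library; skeleton seat `lit-hodgefound-skel-3`, generation 59,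
row **A3-G143** «Milne CM Ex. 3.10 (a)»), layer `Literature/NumberTheory/ComplexMultiplication`, namespace
`Literature.NumberTheory.ComplexMultiplication`.  FILE 2 of the row, at TORUS LEVEL: `X = E/P(ℤ^ι)` a complex torus with
period isomorphism `P : ℝ^ι ≃ E`, `H₁(X, ℚ) = ℚ^ι` (`2 dim X = #ι`), `End_ℚ(X) = endAlgRat P ⊆ M_ι(ℚ) = End(H₁(X, ℚ))`
(the rational matrices commuting with the complex structure `J = jMatrix P`), and «`X` has complex multiplication» =
Milne's Def. 3.2 `[End_ℚ(X) : ℚ]_red = 2 dim X` (A3-G141 `reducedDegree`; ⟺ Lange 7.2.6 (ii) ⟺ Milne 2005 Def. 14.9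
`IsCMAlgTorusRat`, A3-G141 FILE 4).  It consumes BY NAME FILE 1 (`RingTheory/CentralSimple/ReducedDegreeCentralizerSimpleSubalgebra`:
`Matrix.mul_finrank_le_card_of_le_centralizer`, `Matrix.mul_reducedDegree_centralizer_union_eq_card`,
`Matrix.centralizer_comm_of_mul_finrank_eq_card`), A3-G142 FILE 3 (`CMAlgebraTorusMultiplicativeTypeCriterion`:
`centralizer_endAlgRat_comm_iff_reducedDegree_eq_card` — Prop. 3.3 (c) ⟺ (a) for every complex torus — and
`isSemisimple_toLin'_jMatrix`), A3-G142 FILE 2 (`Matrix.exists_comm_isReduced_mem_span_image_ratCast_of_isSemisimple`: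
the semisimple part of a commutative matrix algebra carries `J`), Q134 (`centralizer_le_endAlgRat_of_jMatrix_mem_span`,
`jMatrix_mem_span_centralizer_endAlgRat`) and A3-G141 (`reducedDegree_endAlgRat_le_card` = Prop. 3.1,
`reducedDegree_endAlgRat_eq_card_iff_exists_isCMAlgTorusRat`).  THEOREMS ONLY (no definition, no instance, no named
fact; net debt 0, D-0026).

## The print

J. S. Milne, *Complex Multiplication* (course notes v0.10, 2020) [MilneCM2006], Ch. I §3 p. 29 (open text
`paper:url-8ccc30e4daab`, p0029), VERBATIM: «EXERCISE 3.10 Let `L` be a simple `ℚ`-algebra of finite degree `d²` over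
its centre `F`, and let `A` be an abelian variety containing `L` in its endomorphism algebra.  (a) Show that for any
semisimple commutative `ℚ`-subalgebra `R` of `End⁰_L(A)`, `dim_ℚ R ≤ (2 dim A)/d`, and that equality holds for some `R`
if and only [if] `A` has complex multiplication.»  With §3 p. 27: «PROPOSITION 3.1 For any abelian variety `A`,
`2 dim A ≥ [End⁰(A) : ℚ]_red`», «DEFINITION 3.2 An abelian variety `A` is said to have complex multiplication … if
`2 dim A = [End⁰(A) : ℚ]_red`», «PROPOSITION 3.3 The following conditions on an abelian variety `A` are equivalent: (a)
`A` has complex multiplication; (b) `End⁰(A)` contains an étale subalgebra of degree `2 dim A` over `ℚ`; (c) for any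
Weil cohomology `X ⇝ H*(X)` with coefficient field `Ω`, the centralizer of `End⁰(A)` in `End_Ω(H¹(A))` is commutative».

## Reading (torus level; «semisimple commutative» = commutative reduced, as in every `reducedDegree` file)

`End⁰_L(A)` is the commutant of `L` in `End⁰(A)`; at torus level `End_{ℚ,L}(X) := endAlgRat P ⊓ C(L)`, `C(L)` the
commutant of `L` in `M_ι(ℚ) = End(H₁(X, ℚ))`.  Milne states 3.10 for abelian varieties; the statements below hold for
EVERY complex torus (no polarisation, no semisimplicity of `End_ℚ(X)`), because FILE 1's algebra lives in the central
simple `End(H₁(X, ℚ))` and A3-G142's Prop. 3.3 (c) ⟺ (a) holds for every torus.  The proofs: the BOUND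
`d·dim R ≤ 2 dim X` is FILE 1's `d·[C(L):ℚ]_red = 2 dim X` (Voight 7.7.8 + the reduced degree of a simple algebra over
its centre); «CM ⟹ equality»: the commutant `C(End_ℚ X)` is commutative (Prop. 3.3 (c)), its semisimple part `S` still
carries `J ∈ S ⊗ ℝ` (A3-G142 FILE 2, Bourbaki VIII §13 Cor. 2), so `C(S) ⊆ End_ℚ(X)` (Q134) while `S` commutes with
`L ⊆ End_ℚ(X)`, and FILE 1 gives `d·[C(S ∪ L)]_red = 2 dim X` with `C(S ∪ L) ⊆ End_{ℚ,L}(X)`; «equality ⟹ CM»: a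
commutative reduced `R ⊆ End_{ℚ,L}(X)` with `d·dim R = 2 dim X` has `C(R ∪ L) = R` (FILE 1, Bourbaki §14 n°7 Prop. 4),
so the commutant of `End_ℚ(X) ⊇ R ∪ L` is commutative — Prop. 3.3 (c) ⟹ (a).

## What is formalised (`P : (ι → ℝ) ≃L[ℝ] E`; `L ≤ M_ι(ℚ)` simple with `[L : ℚ] = d²·[Z(L) : ℚ]`)

* §1 **the bound** `mul_finrank_le_card_of_le_endAlgRat_inf_centralizer` (`R ≤ End_{ℚ,L}(X)` commutative reduced ⟹
  `d·dim_ℚ R ≤ #ι = 2 dim X`), `mul_reducedDegree_endAlgRat_inf_centralizer_le_card`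
  (`d·[End_{ℚ,L}(X) : ℚ]_red ≤ 2 dim X` — the relative Prop. 3.1).
* §2 **CM ⟹ equality** `mul_reducedDegree_endAlgRat_inf_centralizer_eq_card_of_cm`,
  `exists_le_endAlgRat_inf_centralizer_mul_finrank_eq_card_of_cm`.
* §3 **equality ⟹ CM** `reducedDegree_endAlgRat_eq_card_of_mul_finrank_eq_card`
  (and the commutant of `End_ℚ(X)` is then commutative and `⊆ R`).
* §4 **EX. 3.10 (a) as an equivalence**, for every complex torus:
  `exists_mul_finrank_eq_card_iff_reducedDegree_endAlgRat_eq_card`,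
  `mul_reducedDegree_endAlgRat_inf_centralizer_eq_card_iff` (the relative Def. 3.2: `d·[End_{ℚ,L}(X) : ℚ]_red = 2 dim X`
  iff `[End_ℚ(X) : ℚ]_red = 2 dim X`), and the Milne 2005 Def. 14.9 form `exists_mul_finrank_eq_card_iff_exists_isCMAlgTorusRat`.
* §5 the case of a CENTRAL simple `L` (`[L : ℚ] = d²`): `exists_mul_finrank_eq_card_iff_reducedDegree_endAlgRat_eq_card_of_isCentral`.

## References

* [MilneCM2006] J. S. Milne, *Complex Multiplication* (2006/2020), Ch. I §3 Exercise 3.10 (a) (p. 29); Prop. 3.1,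
  Def. 3.2, Prop. 3.3 (pp. 27–28); §1 Props. 1.2–1.3 (p. 9).
* [Voight2021] J. Voight, *Quaternion Algebras*, GTM 288 (2021), §7.7 Prop. 7.7.8.
* [BourbakiAlgebreVIII2012] N. Bourbaki, *Algèbre* Ch. VIII (2012), §13 n°7 Cor. 2; §14 n°7 Prop. 4 a), Cor. 1.
* [Milne2005ShimuraVarieties] J. S. Milne, *Introduction to Shimura varieties* (2005), §14 Def. 14.9.
-/

noncomputable section

open Module Matrix

namespace Literature.NumberTheory.ComplexMultiplication

open Literature.RingTheory.CentralSimple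
open Literature.LinearAlgebra
open Literature.Geometry.Kaehler
open Literature.Geometry.Kaehler.ComplexTorus

variable {ι : Type} [Fintype ι] [DecidableEq ι] {E : Type} [NormedAddCommGroup E] [NormedSpace ℂ E]
  (P : (ι → ℝ) ≃L[ℝ] E)

/-! ## §0 Plumbing -/

section Helpers

omit [DecidableEq ι] in
/-- A simple subalgebra of `M_ι(ℚ)` forces `ι ≠ ∅` (a simple ring is non-trivial). [folklore] -/
private theorem nonempty_of_isSimpleRing [DecidableEq ι] (L : Subalgebra ℚ (Matrix ι ι ℚ)) [IsSimpleRing L] :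
    Nonempty ι := by
  by_contra h
  haveI : IsEmpty ι := not_nonempty_iff.1 h
  obtain ⟨x, y, hxy⟩ := exists_pair_ne ↥L
  exact hxy (Subtype.ext (Matrix.ext fun i _ => isEmptyElim i))

/-- A subalgebra is reduced iff it contains no non-zero nilpotent element of the ambient algebra. [folklore] -/
private theorem isReduced_subalgebra_iff₄ {R : Type*} [CommSemiring R] {A : Type*} [Semiring A] [Algebra R A]
    (S : Subalgebra R A) : IsReduced S ↔ ∀ x ∈ S, IsNilpotent x → x = 0 := by
  constructor
  · rintro h x hx ⟨n, hn⟩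
    have h0 : (⟨x, hx⟩ : S) = 0 :=
      h.eq_zero _ ⟨n, Subtype.ext (by rw [SubmonoidClass.coe_pow, ZeroMemClass.coe_zero]; exact hn)⟩
    exact congrArg Subtype.val h0
  · intro h
    refine ⟨fun x hx => ?_⟩
    obtain ⟨n, hn⟩ := hx
    have h1 : (x : A) ^ n = 0 := by rw [← SubmonoidClass.coe_pow, hn, ZeroMemClass.coe_zero]
    exact Subtype.ext (by rw [ZeroMemClass.coe_zero]; exact h x x.2 ⟨n, h1⟩)

/-- The commutant of a union is the intersection of the commutants. [folklore] -/
private theorem centralizer_union_eq_inf' {F : Type*} [Field F] {B : Type*} [Ring B] [Algebra F B] (S T : Set B) :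
    Subalgebra.centralizer F (S ∪ T) = Subalgebra.centralizer F S ⊓ Subalgebra.centralizer F T := by
  ext x
  rw [Algebra.mem_inf, Subalgebra.mem_centralizer_iff, Subalgebra.mem_centralizer_iff,
    Subalgebra.mem_centralizer_iff]
  constructor
  · intro h
    exact ⟨fun g hg => h g (Set.mem_union_left _ hg), fun g hg => h g (Set.mem_union_right _ hg)⟩
  · rintro ⟨h1, h2⟩ g (hg | hg)
    · exact h1 g hg
    · exact h2 g hg

end Helpers

/-! ## §1 The bound: `d · dim_ℚ R ≤ 2 dim X` for every étale `R ⊆ End_{ℚ,L}(X)` -/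

section Bound

variable (L : Subalgebra ℚ (Matrix ι ι ℚ)) [IsSimpleRing L] {d : ℕ}

/-- **MILNE CM EX. 3.10 (a), first clause, for EVERY complex torus `X`** («for any semisimple commutative
`ℚ`-subalgebra `R` of `End⁰_L(A)`, `dim_ℚ R ≤ 2 dim A / d`): for a simple `L ⊆ End(H₁(X, ℚ))` of degree `d` over its
centre and every commutative reduced `R ⊆ End_{ℚ,L}(X) = End_ℚ(X) ⊓ C(L)`, `d · dim_ℚ R ≤ #ι = 2 dim X` (only
`R ⊆ C(L)` is used: FILE 1 `d·[C(L):ℚ]_red = #ι`). [cite: MilneCM2006, Ch. I §3 Exercise 3.10 (a) (p. 29)] [cite: Voight2021, §7.7 Prop. 7.7.8] -/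
theorem mul_finrank_le_card_of_le_endAlgRat_inf_centralizer
    (hd : finrank ℚ L = d ^ 2 * finrank ℚ ↥(Subalgebra.center ℚ ↥L)) (R : Subalgebra ℚ (Matrix ι ι ℚ))
    (hRcomm : ∀ x ∈ R, ∀ y ∈ R, x * y = y * x) [IsReduced R]
    (hR : R ≤ endAlgRat P ⊓ Subalgebra.centralizer ℚ (L : Set (Matrix ι ι ℚ))) :
    d * finrank ℚ R ≤ Fintype.card ι := by
  haveI : Nonempty ι := nonempty_of_isSimpleRing L
  exact Matrix.mul_finrank_le_card_of_le_centralizer L hd R hRcomm (le_trans hR inf_le_right)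

/-- **The relative Prop. 3.1: `d · [End_{ℚ,L}(X) : ℚ]_red ≤ 2 dim X`** for every complex torus and every simple
`L ⊆ End_ℚ(X)` of degree `d` over its centre. [cite: MilneCM2006, Ch. I §3 Exercise 3.10 (a) (p. 29), Prop. 3.1 (p. 27)] -/
theorem mul_reducedDegree_endAlgRat_inf_centralizer_le_card
    (hd : finrank ℚ L = d ^ 2 * finrank ℚ ↥(Subalgebra.center ℚ ↥L)) :
    d * reducedDegree ℚ ↥(endAlgRat P ⊓ Subalgebra.centralizer ℚ (L : Set (Matrix ι ι ℚ))) ≤ Fintype.card ι := by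
  haveI : Nonempty ι := nonempty_of_isSimpleRing L
  set T : Subalgebra ℚ (Matrix ι ι ℚ) := endAlgRat P ⊓ Subalgebra.centralizer ℚ (L : Set (Matrix ι ι ℚ)) with hTdef
  have h := reducedDegree_le_of_injective (Subalgebra.inclusion (inf_le_right : T ≤ _))
    (Subalgebra.inclusion_injective _)
  calc d * reducedDegree ℚ ↥T
      ≤ d * reducedDegree ℚ ↥(Subalgebra.centralizer ℚ (L : Set (Matrix ι ι ℚ))) := Nat.mul_le_mul_left d h
    _ = Fintype.card ι := Matrix.mul_reducedDegree_centralizer_eq_card L hd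

end Bound

/-! ## §2 CM ⟹ equality: an étale `R ⊆ End_{ℚ,L}(X)` with `d · dim_ℚ R = 2 dim X` -/

section CMImpliesEquality

variable (L : Subalgebra ℚ (Matrix ι ι ℚ)) [IsSimpleRing L] {d : ℕ}

/-- **EX. 3.10 (a), «equality holds for some `R` if `A` has complex multiplication», for EVERY complex torus, in
reduced-degree form: CM ⟹ `d · [End_{ℚ,L}(X) : ℚ]_red = 2 dim X`.**  The commutant `C(End_ℚ X)` is commutative (Prop.
3.3 (c), A3-G142), its semisimple part `S` has `J ∈ S ⊗ ℝ` (Bourbaki VIII §13 Cor. 2, A3-G142 FILE 2), so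
`C(S) ⊆ End_ℚ(X)` (Q134) and `S` commutes with `L ⊆ End_ℚ(X)`; FILE 1 (B2) gives `d·[C(S ∪ L)]_red = #ι` with
`C(S ∪ L) ⊆ End_{ℚ,L}(X)`. [cite: MilneCM2006, Ch. I §3 Exercise 3.10 (a) (p. 29), Prop. 3.3 (p. 27)]
[cite: BourbakiAlgebreVIII2012, VIII §13 n°7 Cor. 2 (p. A VIII.240), §14 n°7 Cor. 1 (p. A VIII.260)] -/
theorem mul_reducedDegree_endAlgRat_inf_centralizer_eq_card_of_cm (hLE : L ≤ endAlgRat P)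
    (hd : finrank ℚ L = d ^ 2 * finrank ℚ ↥(Subalgebra.center ℚ ↥L))
    (h : reducedDegree ℚ ↥(endAlgRat P) = Fintype.card ι) :
    d * reducedDegree ℚ ↥(endAlgRat P ⊓ Subalgebra.centralizer ℚ (L : Set (Matrix ι ι ℚ))) = Fintype.card ι := by
  haveI : Nonempty ι := nonempty_of_isSimpleRing L
  apply le_antisymm (mul_reducedDegree_endAlgRat_inf_centralizer_le_card P L hd)
  -- the commutant of `End_ℚ(X)` is commutative; its semisimple part `S` carries `J`
  have hcomm := (centralizer_endAlgRat_comm_iff_reducedDegree_eq_card P).2 h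
  obtain ⟨S, hSle, hScomm, hSred, hJS⟩ :=
    Matrix.exists_comm_isReduced_mem_span_image_ratCast_of_isSemisimple ℝ
      (Subalgebra.centralizer ℚ (endAlgRat P : Set (Matrix ι ι ℚ))) hcomm
      (jMatrix_mem_span_centralizer_endAlgRat P) (isSemisimple_toLin'_jMatrix P)
  haveI := hSred
  -- `C(S) ⊆ End_ℚ(X)` and `L ⊆ C(S)`
  have hCS : Subalgebra.centralizer ℚ (S : Set (Matrix ι ι ℚ)) ≤ endAlgRat P :=
    centralizer_le_endAlgRat_of_jMatrix_mem_span P hJS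
  have hLS : L ≤ Subalgebra.centralizer ℚ (S : Set (Matrix ι ι ℚ)) := fun l hl ↦ by
    rw [Subalgebra.mem_centralizer_iff]
    intro s hs
    exact ((Subalgebra.mem_centralizer_iff ℚ).1 (hSle hs) l (hLE hl)).symm
  -- `C(S ∪ L) ⊆ End_{ℚ,L}(X)` has `d·[·]_red = #ι`
  have hle : Subalgebra.centralizer ℚ ((S : Set (Matrix ι ι ℚ)) ∪ (L : Set (Matrix ι ι ℚ))) ≤
      endAlgRat P ⊓ Subalgebra.centralizer ℚ (L : Set (Matrix ι ι ℚ)) := by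
    rw [centralizer_union_eq_inf']
    exact inf_le_inf_right _ hCS
  have hmono := reducedDegree_le_of_injective (Subalgebra.inclusion hle) (Subalgebra.inclusion_injective hle)
  calc Fintype.card ι
      = d * reducedDegree ℚ ↥(Subalgebra.centralizer ℚ ((S : Set (Matrix ι ι ℚ)) ∪ (L : Set (Matrix ι ι ℚ)))) :=
        (Matrix.mul_reducedDegree_centralizer_union_eq_card S hScomm L hLS hd).symm
    _ ≤ d * reducedDegree ℚ ↥(endAlgRat P ⊓ Subalgebra.centralizer ℚ (L : Set (Matrix ι ι ℚ))) :=
        Nat.mul_le_mul_left d hmono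

/-- **EX. 3.10 (a), «equality holds for some `R` if `A` has complex multiplication», for EVERY complex torus**: if
`[End_ℚ(X) : ℚ]_red = 2 dim X` then `End_{ℚ,L}(X)` contains a commutative reduced `R` with `d · dim_ℚ R = 2 dim X`.
[cite: MilneCM2006, Ch. I §3 Exercise 3.10 (a) (p. 29)] -/
theorem exists_le_endAlgRat_inf_centralizer_mul_finrank_eq_card_of_cm (hLE : L ≤ endAlgRat P)
    (hd : finrank ℚ L = d ^ 2 * finrank ℚ ↥(Subalgebra.center ℚ ↥L))
    (h : reducedDegree ℚ ↥(endAlgRat P) = Fintype.card ι) :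
    ∃ R : Subalgebra ℚ (Matrix ι ι ℚ), R ≤ endAlgRat P ⊓ Subalgebra.centralizer ℚ (L : Set (Matrix ι ι ℚ)) ∧
      (∀ x ∈ R, ∀ y ∈ R, x * y = y * x) ∧ IsReduced R ∧ d * finrank ℚ R = Fintype.card ι := by
  set T : Subalgebra ℚ (Matrix ι ι ℚ) := endAlgRat P ⊓ Subalgebra.centralizer ℚ (L : Set (Matrix ι ι ℚ)) with hTdef
  have hT := mul_reducedDegree_endAlgRat_inf_centralizer_eq_card_of_cm P L hLE hd h
  obtain ⟨R', hR'comm, hR'red, hR'dim⟩ := exists_finrank_eq_reducedDegree (F := ℚ) (B := ↥T)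
  haveI := hR'red
  -- push `R' ⊆ T` forward into `M_ι(ℚ)`
  let ψ := Subalgebra.equivMapOfInjective R' T.val Subtype.val_injective
  refine ⟨R'.map T.val, ?_, ?_, ?_, ?_⟩
  · rintro _ ⟨x, -, rfl⟩
    exact x.2
  · rintro _ ⟨a, ha, rfl⟩ _ ⟨b, hb, rfl⟩
    rw [← map_mul, ← map_mul, hR'comm a ha b hb]
  · exact isReduced_of_injective ψ.symm ψ.symm.injective
  · rw [← hT, ← hR'dim]
    congr 1
    exact ψ.symm.toLinearEquiv.finrank_eq

end CMImpliesEquality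

/-! ## §3 Equality ⟹ CM -/

section EqualityImpliesCM

variable (L : Subalgebra ℚ (Matrix ι ι ℚ)) [IsSimpleRing L] {d : ℕ}

/-- **EX. 3.10 (a), «equality holds for some `R` ONLY IF `A` has complex multiplication», for EVERY complex torus**: a
commutative reduced `R ⊆ End_{ℚ,L}(X)` with `d · dim_ℚ R = 2 dim X` satisfies `C(R ∪ L) = R` (FILE 1, Bourbaki VIII
§14 n°7 Prop. 4 a)), so the commutant of `End_ℚ(X) ⊇ R ∪ L` is commutative, which is CM by Prop. 3.3 (c) ⟹ (a)
(A3-G142). [cite: MilneCM2006, Ch. I §3 Exercise 3.10 (a) (p. 29), Prop. 3.3 (p. 27)]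
[cite: BourbakiAlgebreVIII2012, VIII §14 n°7 Prop. 4 a) (p. A VIII.260)] -/
theorem reducedDegree_endAlgRat_eq_card_of_mul_finrank_eq_card (hLE : L ≤ endAlgRat P)
    (hd : finrank ℚ L = d ^ 2 * finrank ℚ ↥(Subalgebra.center ℚ ↥L)) (R : Subalgebra ℚ (Matrix ι ι ℚ))
    (hRcomm : ∀ x ∈ R, ∀ y ∈ R, x * y = y * x) [IsReduced R]
    (hR : R ≤ endAlgRat P ⊓ Subalgebra.centralizer ℚ (L : Set (Matrix ι ι ℚ)))
    (hdim : d * finrank ℚ R = Fintype.card ι) :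
    reducedDegree ℚ ↥(endAlgRat P) = Fintype.card ι := by
  haveI : Nonempty ι := nonempty_of_isSimpleRing L
  exact (centralizer_endAlgRat_comm_iff_reducedDegree_eq_card P).1
    (Matrix.centralizer_comm_of_mul_finrank_eq_card L hd R hRcomm (le_trans hR inf_le_right) hdim (endAlgRat P) hLE
      (le_trans hR inf_le_left)).2

/-- … and then the commutant of `End_ℚ(X)` in `End(H₁(X, ℚ))` is contained in `R` (= `C(R ∪ L)`): `R` contains the
centre of `End_ℚ(X)` and the whole commutant. [cite: MilneCM2006, Ch. I §3 Exercise 3.10 (a) (p. 29), Prop. 3.3 (c) (p. 27)] -/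
theorem centralizer_endAlgRat_le_of_mul_finrank_eq_card (hLE : L ≤ endAlgRat P)
    (hd : finrank ℚ L = d ^ 2 * finrank ℚ ↥(Subalgebra.center ℚ ↥L)) (R : Subalgebra ℚ (Matrix ι ι ℚ))
    (hRcomm : ∀ x ∈ R, ∀ y ∈ R, x * y = y * x) [IsReduced R]
    (hR : R ≤ endAlgRat P ⊓ Subalgebra.centralizer ℚ (L : Set (Matrix ι ι ℚ)))
    (hdim : d * finrank ℚ R = Fintype.card ι) :
    Subalgebra.centralizer ℚ (endAlgRat P : Set (Matrix ι ι ℚ)) ≤ R := by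
  haveI : Nonempty ι := nonempty_of_isSimpleRing L
  exact (Matrix.centralizer_comm_of_mul_finrank_eq_card L hd R hRcomm (le_trans hR inf_le_right) hdim (endAlgRat P)
    hLE (le_trans hR inf_le_left)).1

end EqualityImpliesCM

/-! ## §4 Exercise 3.10 (a) as an equivalence, for every complex torus -/

section Iff

variable (L : Subalgebra ℚ (Matrix ι ι ℚ)) [IsSimpleRing L] {d : ℕ}

/-- **MILNE CM EX. 3.10 (a) for EVERY complex torus `X`**: for a simple `L ⊆ End_ℚ(X)` of degree `d` over its centre,
`End_{ℚ,L}(X) = End_ℚ(X) ⊓ C(L)` contains a commutative reduced `R` with `d · dim_ℚ R = 2 dim X` («equality holds for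
some `R`») iff `[End_ℚ(X) : ℚ]_red = 2 dim X` («`A` has complex multiplication», Def. 3.2).
[cite: MilneCM2006, Ch. I §3 Exercise 3.10 (a) (p. 29), Def. 3.2 (p. 27)] -/
theorem exists_mul_finrank_eq_card_iff_reducedDegree_endAlgRat_eq_card (hLE : L ≤ endAlgRat P)
    (hd : finrank ℚ L = d ^ 2 * finrank ℚ ↥(Subalgebra.center ℚ ↥L)) :
    (∃ R : Subalgebra ℚ (Matrix ι ι ℚ), R ≤ endAlgRat P ⊓ Subalgebra.centralizer ℚ (L : Set (Matrix ι ι ℚ)) ∧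
        (∀ x ∈ R, ∀ y ∈ R, x * y = y * x) ∧ IsReduced R ∧ d * finrank ℚ R = Fintype.card ι) ↔
      reducedDegree ℚ ↥(endAlgRat P) = Fintype.card ι := by
  constructor
  · rintro ⟨R, hR, hRcomm, hRred, hdim⟩
    exact reducedDegree_endAlgRat_eq_card_of_mul_finrank_eq_card P L hLE hd R hRcomm hR hdim
  · exact exists_le_endAlgRat_inf_centralizer_mul_finrank_eq_card_of_cm P L hLE hd

/-- **The relative Def. 3.2, for every complex torus: `d · [End_{ℚ,L}(X) : ℚ]_red = 2 dim X` iff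
`[End_ℚ(X) : ℚ]_red = 2 dim X`.** [cite: MilneCM2006, Ch. I §3 Exercise 3.10 (a) (p. 29), Def. 3.2 (p. 27)] -/
theorem mul_reducedDegree_endAlgRat_inf_centralizer_eq_card_iff (hLE : L ≤ endAlgRat P)
    (hd : finrank ℚ L = d ^ 2 * finrank ℚ ↥(Subalgebra.center ℚ ↥L)) :
    d * reducedDegree ℚ ↥(endAlgRat P ⊓ Subalgebra.centralizer ℚ (L : Set (Matrix ι ι ℚ))) = Fintype.card ι ↔
      reducedDegree ℚ ↥(endAlgRat P) = Fintype.card ι := by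
  refine ⟨fun h ↦ ?_, mul_reducedDegree_endAlgRat_inf_centralizer_eq_card_of_cm P L hLE hd⟩
  set T : Subalgebra ℚ (Matrix ι ι ℚ) := endAlgRat P ⊓ Subalgebra.centralizer ℚ (L : Set (Matrix ι ι ℚ)) with hTdef
  obtain ⟨R', hR'comm, hR'red, hR'dim⟩ := exists_finrank_eq_reducedDegree (F := ℚ) (B := ↥T)
  haveI := hR'red
  let ψ := Subalgebra.equivMapOfInjective R' T.val Subtype.val_injective
  haveI : IsReduced ↥(R'.map T.val) := isReduced_of_injective ψ.symm ψ.symm.injective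
  refine reducedDegree_endAlgRat_eq_card_of_mul_finrank_eq_card P L hLE hd (R'.map T.val) ?_ ?_ ?_
  · rintro _ ⟨a, ha, rfl⟩ _ ⟨b, hb, rfl⟩
    rw [← map_mul, ← map_mul, hR'comm a ha b hb]
  · rintro _ ⟨x, -, rfl⟩
    exact x.2
  · rw [← h, ← hR'dim]
    congr 1
    exact ψ.symm.toLinearEquiv.finrank_eq

/-- **EX. 3.10 (a) in Milne 2005 Def. 14.9 form, every complex torus**: `End_{ℚ,L}(X)` contains a commutative reduced
`R` with `d · dim_ℚ R = 2 dim X` iff `X` has multiplication by a CM-algebra (a product of number fields acting with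
`H₁(X, ℚ)` free of rank `1`). [cite: MilneCM2006, Ch. I §3 Exercise 3.10 (a) (p. 29)] [cite: Milne2005ShimuraVarieties, §14 Def. 14.9] -/
theorem exists_mul_finrank_eq_card_iff_exists_isCMAlgTorusRat (hLE : L ≤ endAlgRat P)
    (hd : finrank ℚ L = d ^ 2 * finrank ℚ ↥(Subalgebra.center ℚ ↥L)) :
    (∃ R : Subalgebra ℚ (Matrix ι ι ℚ), R ≤ endAlgRat P ⊓ Subalgebra.centralizer ℚ (L : Set (Matrix ι ι ℚ)) ∧
        (∀ x ∈ R, ∀ y ∈ R, x * y = y * x) ∧ IsReduced R ∧ d * finrank ℚ R = Fintype.card ι) ↔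
      ∃ (t : Type) (_ : Fintype t) (K : t → Type) (_ : ∀ i, Field (K i)) (_ : ∀ i, NumberField (K i))
        (ρ : (Π i, K i) →ₐ[ℚ] Matrix ι ι ℚ), IsCMAlgTorusRat P ρ := by
  rw [exists_mul_finrank_eq_card_iff_reducedDegree_endAlgRat_eq_card P L hLE hd]
  exact reducedDegree_endAlgRat_eq_card_iff_exists_isCMAlgTorusRat P

/-- **EX. 3.10 (a) ⟺ Prop. 3.3 (b) (Lange 7.2.6 (ii)), every complex torus**: `End_{ℚ,L}(X)` contains a commutative
reduced `R` with `d · dim_ℚ R = 2 dim X` iff `End_ℚ(X)` contains a commutative reduced algebra of dimension `2 dim X`.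
[cite: MilneCM2006, Ch. I §3 Exercise 3.10 (a) (p. 29), Prop. 3.3 (a) ⟺ (b) (pp. 27–28)] -/
theorem exists_mul_finrank_eq_card_iff_exists_comm_isReduced_finrank_eq_card (hLE : L ≤ endAlgRat P)
    (hd : finrank ℚ L = d ^ 2 * finrank ℚ ↥(Subalgebra.center ℚ ↥L)) :
    (∃ R : Subalgebra ℚ (Matrix ι ι ℚ), R ≤ endAlgRat P ⊓ Subalgebra.centralizer ℚ (L : Set (Matrix ι ι ℚ)) ∧
        (∀ x ∈ R, ∀ y ∈ R, x * y = y * x) ∧ IsReduced R ∧ d * finrank ℚ R = Fintype.card ι) ↔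
      ∃ T ≤ endAlgRat P, IsReduced ↥T ∧ (∀ a ∈ T, ∀ b ∈ T, a * b = b * a) ∧ finrank ℚ ↥T = Fintype.card ι := by
  rw [exists_mul_finrank_eq_card_iff_reducedDegree_endAlgRat_eq_card P L hLE hd]
  exact reducedDegree_endAlgRat_eq_card_iff_exists_comm_isReduced P

end Iff

/-! ## §5 A central simple `L ⊆ End_ℚ(X)`: `[L : ℚ] = d²` -/

section Central

variable (L : Subalgebra ℚ (Matrix ι ι ℚ)) [IsSimpleRing L] [Algebra.IsCentral ℚ ↥L] {d : ℕ}

/-- For a central simple `L`, `[L : ℚ] = d²·[Z(L) : ℚ]` reads `[L : ℚ] = d²`. [folklore] -/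
private theorem finrank_eq_sq_mul_center (hd : finrank ℚ L = d ^ 2) :
    finrank ℚ L = d ^ 2 * finrank ℚ ↥(Subalgebra.center ℚ ↥L) := by
  rw [hd, Algebra.IsCentral.center_eq_bot, Subalgebra.finrank_bot, mul_one]

/-- **EX. 3.10 (a) for a CENTRAL simple `L ⊆ End_ℚ(X)` with `[L : ℚ] = d²`** (e.g. a quaternion algebra, `d = 2`:
«`X` has CM iff `End_{ℚ,L}(X)` contains an étale algebra of dimension `dim X`»), every complex torus: the bound
`d · dim_ℚ R ≤ 2 dim X` and the equivalence «equality for some `R` ⟺ CM». [cite: MilneCM2006, Ch. I §3 Exercise 3.10 (a) (p. 29)] -/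
theorem exists_mul_finrank_eq_card_iff_reducedDegree_endAlgRat_eq_card_of_isCentral (hLE : L ≤ endAlgRat P)
    (hd : finrank ℚ L = d ^ 2) :
    (∀ R : Subalgebra ℚ (Matrix ι ι ℚ), R ≤ endAlgRat P ⊓ Subalgebra.centralizer ℚ (L : Set (Matrix ι ι ℚ)) →
        (∀ x ∈ R, ∀ y ∈ R, x * y = y * x) → IsReduced R → d * finrank ℚ R ≤ Fintype.card ι) ∧
      ((∃ R : Subalgebra ℚ (Matrix ι ι ℚ), R ≤ endAlgRat P ⊓ Subalgebra.centralizer ℚ (L : Set (Matrix ι ι ℚ)) ∧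
          (∀ x ∈ R, ∀ y ∈ R, x * y = y * x) ∧ IsReduced R ∧ d * finrank ℚ R = Fintype.card ι) ↔
        reducedDegree ℚ ↥(endAlgRat P) = Fintype.card ι) :=
  ⟨fun R hR hRcomm _ ↦ mul_finrank_le_card_of_le_endAlgRat_inf_centralizer P L (finrank_eq_sq_mul_center L hd) R
      hRcomm hR,
    exists_mul_finrank_eq_card_iff_reducedDegree_endAlgRat_eq_card P L hLE (finrank_eq_sq_mul_center L hd)⟩

end Central

end Literature.NumberTheory.ComplexMultiplication

end
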